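import Summits.HodgeConjecture.CorCM.B01.Transposition.HComp.ComplexRecordSystemOfPieces   -- ★ `CorCM.HComp.nonempty_complexRecordSystem_K3`, carriers `CorCM.CMField` ∕ `CorCM.HermSpace3`, `Model.frameOf`, `HComp.K3`
import Summits.HodgeConjecture.HodgeCM.Proofs.Pohlmann.NonGaloisWitness                    -- ★ toy2 ∕ pohl: the sextic CM field `K₂ = ℚ(β₀, i) ⊂ ℂ` (kernel-built, nothing cited)
import HarnessLib

/-!
# NONVAC-V₂ — ONE CONCRETE DATUM `(F, ι₁, V, h4)` of the `HDel` ∕ HC_CM statement, kernel-inhabited (cell `hodgecm-mathlib`, director g15 s451 (c))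

HONEST LABEL: HC_CM is proved only modulo the 7 printed citations until rung 0 closes (as of this file: modulo 2 of them by name,
`hLiu418` = stmt-HodgeConjecture-24832 and `h413` = stmt-24833).  This is a `--supports stmt-HodgeConjecture-24832 --as helper` file of
the CLOSURE AUDIT of `HDel` (director `director/F0/reg/CLOSURE-AUDIT-HDel.directorg15.md` c91f0579 §4, REF1 `F0/reg/CLOSURE-AUDIT-HDel.REF1.md`
405bebff §(d)(e), main's ruling 04:08Z 08-31 «NONVAC-V₂ required»): it proves nothing about Hodge classes and closes no item.  It answers
the statement-level NON-VACUITY question of the audit BY A TERM: the parameter datum over which `canonicalModel_exists_printed` ∕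
`HDel_holds` and HC_CM's `nonempty_complexRecordSystem_K3` quantify — a CM field `F : CorCM.CMField` with `4 ≤ [F:ℚ]`, an
embedding `ι₁ : F →+* ℂ`, and a hermitian 3-space `V : CorCM.HermSpace3 F ι₁` (signature `(2,1)` at `ι₁`, definite elsewhere) —
is INHABITED in the kernel, and the complex record system of Deligne's canonical model below Liu's level `K_f(3)` is inhabited at it.

THE DATUM (REF1 §(d)(e), simplified).
* (i) `K₂CorCM : CorCM.CMField := ⟨HodgeCM.SexticCM.K₂⟩` — toy2 ∕ pohl's sextic CM field `K₂ = ℚ(β₀, i) ⊂ ℂ` (`β₀ = 2 − α₀`, `α₀` the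
  least root of `x³ − 4x + 1`; `F⁺ = ℚ(β₀)` totally real cubic of discriminant `229`, NOT normal; `[K₂:ℚ] = 6`, `Aut(K₂/ℚ) = {1, c}`,
  ★ `HodgeCM.SexticCM.instIsCMFieldK₂ ∕ finrank_K₂ ∕ not_isGalois_K₂`), re-bundled in the CorCM carrier (one anonymous-constructor
  token; the HodgeCM-side bundle ★ `HodgeCM.SexticCM.K₂CM` is the homonymous structure); `four_le_finrank_K₂CorCM`.
* (ii) `ι₁ := algebraMap K₂ ℂ` (the inclusion, `β₀ ↦ β₀`, `i ↦ i`) and `V₂ : CorCM.HermSpace3 K₂CorCM ι₁` with Gram matrix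
  `Hm := diag(1, 1, 3 − β₀)`.  SIGN ENGINE = toy2's root boxes ★ `HodgeCM.SexticCM.α_spec` (`α₀ ≤ −2`, `0 ≤ α₁ ≤ 1`, `3/2 ≤ α₂ < 2`), i.e.
  `β₀ ≥ 4 > 3 > 2 ≥ β₁, β₂ > 0`: at `ι₁` the entry `3 − β₀ ≤ −1` is NEGATIVE (signature `(2,1)`, Sylvester frame
  `T = diag(1, 1, (√(β₀ − 3))⁻¹)`), while every embedding `φ` OFF the place of `ι₁` sends `β₀ ↦ β_k` with `k ≠ 0`
  (`exists_ne_zero_of_mk_ne`: a ring map `K₂ → ℂ` is determined by `(φ β₀, φ i)`, ★ `emb_bK₂` ∕ `emb_iK₂`, and `φ i = −i` is the conjugate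
  place, Mathlib `InfinitePlace.mk_eq_iff`), where `3 − β_k ≥ 1 > 0` (positive definite, Mathlib `Matrix.PosDef.diagonal` under
  `ComplexOrder`).  Hermitian symmetry: the entries lie in the real subfield (★ `conjAlgEquiv_bK₂`, `cmConjRingHom = IsCMField.complexConj`).
  (REF1 §(e) proposed `a := (β₀ − r)² − q`; the linear `a := 3 − β₀` has the same sign pattern (−,+,+) with no rational approximation.)
* (iii) `nonempty_complexRecordSystem_K₂ : Nonempty (ComplexRecordSystem K₂CorCM V₂.Hm ι₁ (Model.frameOf V₂) (Model.formCongr_frameOf V₂) (HComp.K3 V₂))`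
  `:= CorCM.HComp.nonempty_complexRecordSystem_K3 V₂ four_le_finrank_K₂CorCM` — HYPOTHESIS-FREE: the `∀ Sc : ComplexRecordSystem …`
  binder of `canonicalModel_exists_printed` is inhabited at an actual datum built in the kernel (no named fact anywhere in the closure of
  this file's new declarations beyond what ★ `nonempty_complexRecordSystem_K3` itself uses — none, per its docstring).

Three definitions (the deliverable IS a term: `K₂CorCM` (an `abbrev`, so that `(K₂CorCM : Type)` is reducibly `↥K₂`), `ι₁`, `V₂`) and one
auxiliary `gramDiag`, all inside a `noncomputable section`; fourteen theorems, 0 `instance` ∕ `notation` ∕ `axiom` ∕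
`sorry`.  Nothing is cited beyond the carriers' own locators; the arithmetic is kernel numerics of toy2's cubic.  Filer: B-p05 (g21).
-/

-- the mandated namespace has the single-problem summit's repeated segment (`HodgeConjecture.HodgeConjecture`)
set_option linter.dupNamespace false

noncomputable section

open NumberField NumberField.ComplexEmbedding IntermediateField Matrix
open scoped Matrix ComplexOrder
open HodgeCM.SexticCM
open Literature.NumberTheory.Automorphic (cmConjRingHom cmConjRingHom_apply)
open Literature.AlgebraicGeometry.ShimuraVarieties

namespace Summit.HodgeConjecture.HodgeConjecture.Theorems.HCCMNonvacuityHermSpace3K2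

/-! ## (i) The CM field of the datum: `K₂ = ℚ(β₀, i)` in the CorCM carrier -/

/-- **The sextic CM field `K₂ = ℚ(β₀, i) ⊂ ℂ` as a term of HC_CM's CM-field carrier `Summit.HodgeConjecture.CorCM.CMField`**
(toy2 ∕ pohl, ★ `HodgeCM.SexticCM.K₂` with ★ `instIsCMFieldK₂ = IsCMField.ofCMExtension F K₂`; REF1 CLOSURE-AUDIT §(d) verbatim).
[cite: Deligne1979ShimuraVarieties, 2.1.2–2.1.4 (PDF p. 24 of Milne's translation)] -/
abbrev K₂CorCM : Summit.HodgeConjecture.CorCM.CMField := ⟨K₂⟩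

/-- `[K₂ : ℚ] = 6 ≥ 4` — the degree side condition `h4` of ★ `CorCM.HComp.nonempty_complexRecordSystem_K3` (and of HC_CM's
anisotropy lemma ★ `HermSpace3.anisotropic_of_four_le`) is met by the datum. [cite: Liu2021, App. C l. 4599 and Prop. C.5 l. 4627–4628] -/
theorem four_le_finrank_K₂CorCM : 4 ≤ Module.finrank ℚ K₂CorCM := by
  show 4 ≤ Module.finrank ℚ K₂
  rw [finrank_K₂]; norm_num

/-- **The distinguished embedding `ι₁ : K₂ → ℂ`** = the inclusion of the subfield `K₂ ⊂ ℂ` (`β₀ ↦ β₀`, `i ↦ i`); the place of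
signature `(2,1)`. [cite: Deligne1979ShimuraVarieties, 2.1.2–2.1.4 (PDF p. 24 of Milne's translation)] -/
def ι₁ : K₂ →+* ℂ := algebraMap K₂ ℂ

/-- `ι₁` on elements is the coercion `K₂ ⊂ ℂ`. [folklore] -/
theorem ι₁_apply (x : K₂) : ι₁ x = (x : ℂ) := rfl

/-! ## The sign engine: root boxes of `x³ − 4x + 1` and the embeddings of `K₂` -/

/-- `β₀ = 2 − α₀ ≥ 4` (toy2's box `α₀ ≤ −2`). [folklore] -/
theorem four_le_β_zero : 4 ≤ β 0 := by
  have h := α_spec.2.2.2.1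
  unfold β; linarith

/-- `β_k = 2 − α_k ≤ 2` for `k ≠ 0` (toy2's boxes `0 ≤ α₁`, `3/2 ≤ α₂`). [folklore] -/
theorem β_le_two {k : Fin 3} (hk : k ≠ 0) : β k ≤ 2 := by
  have h1 := α_spec.2.2.2.2.1
  have h2 := α_spec.2.2.2.2.2.2.1
  fin_cases k
  · exact absurd rfl hk
  · show 2 - α 1 ≤ 2
    linarith
  · show 2 - α 2 ≤ 2
    linarith

/-- A ring map `K₂ = ℚ(β₀, i) → ℂ` is determined by its values on the two generators `β₀` and `i`
(pattern of ★ `HodgeCM.SexticCM.aut_ext` ∕ `ringHom_Qi_ext`). [folklore] -/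
theorem ringHom_K₂_ext {k k' : K₂ →+* ℂ} (hb : k bK₂ = k' bK₂) (hi : k iK₂ = k' iK₂) : k = k' := by
  suffices hs : k.toRatAlgHom = k'.toRatAlgHom by
    have := congrArg AlgHom.toRingHom hs
    simpa using this
  apply adjoin_algHom_ext ℚ
  intro x hx
  rcases Set.mem_insert_iff.mp hx with rfl | hx
  · exact hb
  · rw [Set.mem_singleton_iff] at hx
    subst hx
    exact hi

/-- **Off the place of `ι₁`, `β₀` goes to ANOTHER root**: if `φ : K₂ → ℂ` is not in the infinite place of the inclusion then
`φ β₀ = β_k` with `k ≠ 0` — since `φ β₀ = β₀` together with `φ i = i` (resp. `φ i = −i`) forces `φ = ι₁` (resp. `φ̄ = ι₁`), i.e.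
the same place (Mathlib `InfinitePlace.mk_eq_iff`). [folklore] -/
theorem exists_ne_zero_of_mk_ne (φ : K₂ →+* ℂ) (hφ : InfinitePlace.mk φ ≠ InfinitePlace.mk (algebraMap K₂ ℂ)) :
    ∃ k : Fin 3, k ≠ 0 ∧ φ bK₂ = ((β k : ℝ) : ℂ) := by
  obtain ⟨k, hk⟩ := emb_bK₂ φ
  refine ⟨k, ?_, hk⟩
  rintro rfl
  apply hφ
  rw [InfinitePlace.mk_eq_iff]
  rcases emb_iK₂ φ with hi | hi
  · left
    exact ringHom_K₂_ext (by rw [hk]; rfl) (by rw [hi]; rfl)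
  · right
    refine ringHom_K₂_ext ?_ ?_
    · rw [conjugate_coe_eq, hk, Complex.conj_ofReal]; rfl
    · rw [conjugate_coe_eq, hi, map_neg, Complex.conj_I, neg_neg]; rfl

/-! ## (ii) The hermitian 3-space `V₂ = ⟨1, 1, 3 − β₀⟩` over `K₂` -/

/-- The diagonal of the Gram matrix: `(1, 1, 3 − β₀)`, entries in the real subfield `ℚ(β₀) ⊂ K₂`. [folklore] -/
def gramDiag : Fin 3 → K₂ := ![1, 1, 3 - bK₂]

/-- Complex conjugation of `K₂` fixes every entry of `gramDiag` (they are real: ★ `conjAlgEquiv_bK₂`). [folklore] -/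
theorem cmConjRingHom_gramDiag (i : Fin 3) : cmConjRingHom K₂ (gramDiag i) = gramDiag i := by
  have hb : cmConjRingHom K₂ bK₂ = bK₂ := conjAlgEquiv_bK₂
  fin_cases i
  · exact map_one _
  · exact map_one _
  · show cmConjRingHom K₂ (3 - bK₂) = 3 - bK₂
    rw [map_sub, map_ofNat, hb]

/-- The Gram matrix read in `ℂ` through an embedding `φ`: `diag(φ 1, φ 1, φ (3 − β₀)) = diag(1, 1, 3 − φ β₀)`. [folklore] -/
theorem map_diagonal_gramDiag (φ : K₂ →+* ℂ) :
    (diagonal gramDiag).map φ = diagonal ![(1 : ℂ), 1, 3 - φ bK₂] := by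
  rw [diagonal_map (map_zero φ)]
  refine congrArg diagonal (funext fun i ↦ ?_)
  fin_cases i
  · exact map_one φ
  · exact map_one φ
  · show φ (3 - bK₂) = 3 - φ bK₂
    rw [map_sub, map_ofNat]

/-- `0 < β₀ − 3` (indeed `≥ 1`). [folklore] -/
theorem β_zero_sub_three_pos : 0 < β 0 - 3 := by linarith [four_le_β_zero]

/-- **Signature `(2,1)` at `ι₁`**: with `c := (√(β₀ − 3))⁻¹` and `T := diag(1, 1, c)`, `Tᴴ · diag(1, 1, 3 − β₀) · T = diag(1, 1, −1)`
(`c² (3 − β₀) = −1`). [folklore] -/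
theorem signature_ι₁_gramDiag :
    ∃ T : GL (Fin 3) ℂ, (T : Matrix (Fin 3) (Fin 3) ℂ)ᴴ * (diagonal gramDiag).map ι₁ * (T : Matrix (Fin 3) (Fin 3) ℂ) =
      signatureMatrix 2 := by
  set c : ℝ := (Real.sqrt (β 0 - 3))⁻¹ with hc
  have hsqrt_pos : 0 < Real.sqrt (β 0 - 3) := Real.sqrt_pos.mpr β_zero_sub_three_pos
  have hc_pos : 0 < c := inv_pos.mpr hsqrt_pos
  have hcc : (c : ℂ) * (3 - ((β 0 : ℝ) : ℂ)) * (c : ℂ) = -1 := by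
    have hsq : Real.sqrt (β 0 - 3) * Real.sqrt (β 0 - 3) = β 0 - 3 := Real.mul_self_sqrt β_zero_sub_three_pos.le
    have hreal : c * (3 - β 0) * c = -1 := by
      have hne : Real.sqrt (β 0 - 3) ≠ 0 := hsqrt_pos.ne'
      rw [hc]
      field_simp
      linarith [hsq]
    have h := congrArg (fun r : ℝ ↦ (r : ℂ)) hreal
    push_cast at h
    exact h
  let d : Fin 3 → ℂ := ![1, 1, (c : ℂ)]
  have hdet : (diagonal d).det ≠ 0 := by
    rw [det_diagonal, Fin.prod_univ_three]
    show (1 : ℂ) * 1 * (c : ℂ) ≠ 0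
    rw [one_mul, one_mul]
    exact_mod_cast hc_pos.ne'
  refine ⟨Matrix.GeneralLinearGroup.mkOfDetNeZero (diagonal d) hdet, ?_⟩
  show (diagonal d)ᴴ * (diagonal gramDiag).map ι₁ * diagonal d = signatureMatrix 2
  rw [map_diagonal_gramDiag, diagonal_conjTranspose, diagonal_mul_diagonal, diagonal_mul_diagonal, signatureMatrix,
    diagonal_eq_diagonal_iff]
  intro i
  fin_cases i
  · simp [d]
  · simp [d]
  · show star (c : ℂ) * (3 - ι₁ bK₂) * (c : ℂ) = if (2 : Fin 3) = Fin.last 2 then -1 else 1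
    rw [if_pos (show (2 : Fin 3) = Fin.last 2 from rfl), ι₁_apply, coe_bK₂, Complex.star_def, Complex.conj_ofReal, hcc]

/-- **Positive definite off the place of `ι₁`**: at an embedding `φ` of another place, `φ β₀ = β_k` with `k ≠ 0`, so the Gram
matrix reads `diag(1, 1, 3 − β_k)` with `3 − β_k ≥ 1 > 0`. [folklore] -/
theorem posDef_gramDiag_of_ne (φ : K₂ →+* ℂ) (hφ : InfinitePlace.mk φ ≠ InfinitePlace.mk (algebraMap K₂ ℂ)) :
    ((diagonal gramDiag).map φ).PosDef := by
  obtain ⟨k, hk, hφk⟩ := exists_ne_zero_of_mk_ne φ hφ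
  have hpos : 0 < 3 - β k := by linarith [β_le_two hk]
  rw [map_diagonal_gramDiag, hφk]
  refine Matrix.PosDef.diagonal fun i ↦ ?_
  fin_cases i
  · exact zero_lt_one
  · exact zero_lt_one
  · show (0 : ℂ) < 3 - ((β k : ℝ) : ℂ)
    have h : ((3 - β k : ℝ) : ℂ) = 3 - ((β k : ℝ) : ℂ) := by push_cast; rfl
    rw [← h]
    exact Complex.zero_lt_real.mpr hpos

/-- **THE HERMITIAN 3-SPACE OF THE DATUM: `V₂ = (K₂³, ⟨1, 1, 3 − β₀⟩)`** — a term of HC_CM's carrier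
`Summit.HodgeConjecture.CorCM.HermSpace3 K₂CorCM ι₁`: Gram matrix `diag(1, 1, 3 − β₀)`, hermitian (real entries), of signature `(2,1)` at
the inclusion `ι₁ : K₂ ⊂ ℂ` (`3 − β₀ ≤ −1 < 0`) and positive definite at the two other complex places (`3 − β₁, 3 − β₂ ≥ 1 > 0`) — the
«compact unitary» shape `U(2,1) × U(3) × U(3)` of [Deligne1979] §2 ∕ BMM Part 2 §1.1 over a NON-Galois sextic CM field.
[cite: Deligne1979ShimuraVarieties, 2.1.2–2.1.4 (PDF p. 24 of Milne's translation)] [cite: BergeronMillsonMoeglin2016Balls, Part 2 §1.1] -/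
def V₂ : Summit.HodgeConjecture.CorCM.HermSpace3 K₂CorCM ι₁ where
  Hm := diagonal gramDiag
  isHermitian i j := by
    show cmConjRingHom K₂ (diagonal gramDiag i j) = diagonal gramDiag j i
    by_cases hij : i = j
    · subst hij
      rw [diagonal_apply_eq, cmConjRingHom_gramDiag]
    · rw [diagonal_apply_ne _ hij, diagonal_apply_ne _ (Ne.symm hij), map_zero]
  signature_ι₁ := signature_ι₁_gramDiag
  posDef_of_ne τ hτ := posDef_gramDiag_of_ne τ hτ

/-- The Gram matrix of `V₂` is `diag(1, 1, 3 − β₀)`. [folklore] -/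
theorem V₂_Hm : V₂.Hm = diagonal gramDiag := rfl

/-! ## (iii) The complex record system of Deligne's canonical model is inhabited AT THIS DATUM -/

/-- **NONVAC-V₂ — the `∀ Sc : ComplexRecordSystem …` binder of `canonicalModel_exists_printed` ∕ `HDel_holds` is inhabited at a
kernel-built datum**: for the sextic CM field `K₂ = ℚ(β₀, i)`, the inclusion `ι₁ : K₂ ⊂ ℂ` and the hermitian 3-space
`V₂ = ⟨1, 1, 3 − β₀⟩`, in the chosen Sylvester frame ★ `CorCM.Model.frameOf V₂` and below Liu's level ★ `CorCM.HComp.K3 V₂ = K_f(3)`,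
the complex record system of `Sh(U(V₂), 𝔹²)` (functor `K ↦ Mc_K` of smooth projective complex surfaces with
`Mc_K(ℂ) ≃ Sh_K(ℂ)`, Hecke transitions, ball holomorphy) EXISTS — ★ `CorCM.HComp.nonempty_complexRecordSystem_K3` at
`(V₂, four_le_finrank_K₂CorCM)`.  HYPOTHESIS-FREE; no named fact.  HC_CM is proved only modulo the 7 printed citations until rung 0
closes; this theorem is about non-vacuity of its datum, not about Hodge classes.
[cite: Deligne1979ShimuraVarieties, 2.1.2–2.1.4 (PDF p. 24 of Milne's translation)] [cite: Liu2021, App. C l. 4599 and Prop. C.5 l. 4627–4628] -/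
theorem nonempty_complexRecordSystem_K₂ :
    Nonempty (UnitaryCanonicalModel.ComplexRecordSystem K₂CorCM V₂.Hm ι₁ (Summit.HodgeConjecture.CorCM.Model.frameOf V₂)
      (Summit.HodgeConjecture.CorCM.Model.formCongr_frameOf V₂) (Summit.HodgeConjecture.CorCM.HComp.K3 V₂)) :=
  Summit.HodgeConjecture.CorCM.HComp.nonempty_complexRecordSystem_K3 V₂ four_le_finrank_K₂CorCM

/-- **Corollary — the three carriers of the audit are inhabited TOGETHER**: there are a CM field `F` with `4 ≤ [F:ℚ]`, an embedding
`ι₁` and a hermitian 3-space `V : CorCM.HermSpace3 F ι₁` whose complex record system below `K_f(3)` is inhabited (witness: the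
datum above). [cite: Deligne1979ShimuraVarieties, 2.1.2–2.1.4 (PDF p. 24 of Milne's translation)] -/
theorem exists_datum_nonempty_complexRecordSystem :
    ∃ (F : Summit.HodgeConjecture.CorCM.CMField) (ι : F →+* ℂ) (V : Summit.HodgeConjecture.CorCM.HermSpace3 F ι),
      4 ≤ Module.finrank ℚ F ∧
      Nonempty (UnitaryCanonicalModel.ComplexRecordSystem F V.Hm ι (Summit.HodgeConjecture.CorCM.Model.frameOf V)
        (Summit.HodgeConjecture.CorCM.Model.formCongr_frameOf V) (Summit.HodgeConjecture.CorCM.HComp.K3 V)) :=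
  ⟨K₂CorCM, ι₁, V₂, four_le_finrank_K₂CorCM, nonempty_complexRecordSystem_K₂⟩

end Summit.HodgeConjecture.HodgeConjecture.Theorems.HCCMNonvacuityHermSpace3K2

end
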